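import Literature.NumberTheory.ComplexMultiplication.EllipticUnits.ImaginaryQuadraticMainConjectureLocalTwistUntwist
import Literature.NumberTheory.GaloisRepresentations.LocalTwoMuConjTrivial
import Literature.NumberTheory.GaloisRepresentations.LocalGlobalCohomologyTateProofs
import Literature.NumberTheory.GaloisRepresentations.ContinuousCohomologyConjTwistIndex
import Literature.NumberTheory.GaloisRepresentations.CorestrictionSubgroupOfConj
import HarnessLib

/-!
# The local `H²`-inputs of the class-group row at `p`: kill `4·c = 0` and conjugation `2·(δ·c − θ′(δ)c) = 0`
# on `H²(Λ, res_{φ_v}(μ_{p^k} ⊗ θ′)^{N_S})`, from the (now proved) triviality of `Γ_{K_v}` on `H²(·, μ_{p^k})`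

For the class-group row `Φ : X_∞(χ) → H¹_unr(K̃_∞, (F/𝓞)(θ))^∨` of the two-variable main conjecture (Johnson-Leung–Kings §5.4,
Rubin §4; the cell's ROW 1 of `stub_classGroupHalf`), the cokernel bound `JLKDescent.classGroupRow_hfcoker`
(`Summits/…/PrintCf2RubinValueTwoJLKDescentRowOneCokernel.lean`) asks, at every place `v ∈ supp(p𝔣)`, for ONE of two local statements on
`H²(Λ, X_tw)`, `X_tw = res_{φ_v}(μ_{p^k} ⊗ θ′)^{N_S}` the twisted local coefficients and `Λ = Λ_n^{(v)} ⊴ Γ_{K_v}` the local layer groups: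
a KILL `p^e·c = 0`, or a CONJUGATION law `p^e·(δ·c − u·c) = 0`.  This file proves both from material now in the tree, for `k ≥ 2` and
`θ′ ∘ res_v` with values `±1` (the quadratic case of the `p = 2` cell):

* §1 generic supplements: `nsmul_two_eq_zero_of_forall` (`n·H² = 0` when `n·X = 0`), and the transport of an eigen-relation
  `conj_{g₀} = u` from `H^q(V', M)` to `H^q(V'.subgroupOf V, M|_V)` (ambient group `↥V`), `conjMap_restrict_subgroupOf_eq_zsmul`
  (`conjMap_restrict_subgroupOf_eq_conjMapSubOf` + the equivariant mutually inverse comparisons of `CorestrictionSubgroupOfConj.lean`);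
* §2 `conjMap_two_muRestrict_eq_self` — **(LI) for the untwisted local coefficients `μ_{p^k}(K̄)|_{Γ_{K_v}}`**: `Γ_{K_v}` acts trivially on
  `H²(N, ·)` for `N ⊴ Γ_{K_v}` open with abelian quotient and `k ≥ 2` — `conjMap_two_mu_eq_self_of_comm_mem` (`LocalTwoMuConjTrivial.lean`,
  local field `K_v`) transported along `muLocalIso : μ_{p^k}(K̄)|_{Γ_{K_v}} ≅ μ_{p^k}(K̄_v)` (twist law with `u = 1`);
* §3 per place: `isOpen_ker_comp_absGaloisRestrict` (`K₀ = ker(θ′∘res_v)` is open), `conjMap_two_inf_ker_eq_zsmul` (`δ` acts on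
  `H²(Λ ∩ K₀, X_tw)` as `(θ′(res_v δ) mod p^k).val`, by `conjMap_two_eq_zsmul_of_untwisted_trivial`), `index_inf_ker_subgroupOf`
  (`(Λ : Λ ∩ K₀) ∈ {1,2}`), and the two deliverables
  **`two_smul_conjMap_sub_zsmul_eq_zero`** — `2·(δ·c − (θ′(res_v δ) mod p^k).val·c) = 0` for EVERY `δ ∈ Γ_{K_v}` (restriction to `Λ ∩ K₀`
  kills the difference, `resLe_conjMap`; a class dying on a subgroup of index `∣ 2` is killed by `2`, `index_smul_eq_zero_of_resH_eq_zero`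
  through `toSubgroupOf_resLe`), and
  **`four_smul_eq_zero_of_apply_eq_neg_one`** — `4·c = 0` as soon as `Λ` contains `g₀` with `θ′(res_v g₀) = −1` (`g₀` acts as `−1` on
  `H²(Λ ∩ K₀, ·)`, `p^k`-torsion; `index_smul_zsmul_eq_zero_of_conjMap_eq_zsmul` in the ambient group `↥Λ`).

For `k ≤ 1` both statements with `p^k` in place of `2`, `4` are instances of `nsmul_two_eq_zero_of_forall`; so with `p = 2` the exponent `e = 3`
serves `hplaces` uniformly.  Hypotheses a consumer discharges in the `D = −7` frame: `Λ_n^{(v)}` open normal with `Γ_{K_v}/Λ_n^{(v)}` abelian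
(preimage of the layer subgroup of the `ℤ_2²`-tower), `θ′² = 1`, `N_S ≤ ker(μ ⊗ θ′)`, and at the conductor places an inertia element `g₀` with
`θ′(g₀) = −1` (it lies in every `Λ_n^{(v)}`).  THEOREMS ONLY (no definition, no named fact, no instance, no `sorry`).

## References
* J. Johnson-Leung, G. Kings, *On the equivariant main conjecture for imaginary quadratic fields*, J. reine angew. Math. 653 (2011),
  §5.4 Lemma 5.8. [JohnsonLeungKings2011]
* J.-P. Serre, *Local Fields* (1979), VII §5 Prop. 3, XI §2 Prop. 1 (ii), XIII §3 Prop. 7. [SerreLocalFields1979]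
* J.-P. Serre, *Galois Cohomology* (1997), I §2.2, I §2.4 Prop. 9, I §2.5. [SerreGaloisCohomology1997]
* J. Neukirch, A. Schmidt, K. Wingberg, *Cohomology of Number Fields* (2008), I §5 Prop. 1.5.4. [NeukirchSchmidtWingberg2008]
-/

noncomputable section

open scoped NumberField
open CategoryTheory Function Field IsDedekindDomain NumberField
open Literature.NumberTheory.GaloisRepresentations
open Literature.NumberTheory.GaloisRepresentations.DiscreteGaloisModule
open Literature.NumberTheory.EllipticCurves (subgroupConj subgroupInclusion)

/-! ## §1 Generic supplements -/

namespace Literature.NumberTheory.GaloisRepresentations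

open _root_.TopRep _root_.ContinuousCohomology

section Torsion

universe u v

variable {R : Type u} [CommRing R] [TopologicalSpace R]
variable {G : Type v} [Group G] [TopologicalSpace G] [IsTopologicalGroup G] [LocallyCompactSpace G]

/-- **`n · H²(G, X) = 0` when `n · X = 0`** (on cocycles). [cite: SerreGaloisCohomology1997, I §2.2] -/
theorem nsmul_two_eq_zero_of_forall (X : TopRep.{v} R G) (n : ℕ) (hX : ∀ v : X, n • v = 0)
    (c : continuousCohomology 2 X) : n • c = 0 := by
  obtain ⟨z, rfl⟩ := twoCocycleClass_surjective X c
  have hz : n • z = 0 := Subtype.ext (ContinuousMap.ext fun q => by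
    change n • z.1 q = 0
    exact hX _)
  rw [← twoCocycleClassₗ_apply, ← map_nsmul, hz, map_zero]

end Torsion

section Transport

universe u

variable {Γ : Type u} [Group Γ] [TopologicalSpace Γ] [IsTopologicalGroup Γ] [CompactSpace Γ]
  [T2Space Γ] [TotallyDisconnectedSpace Γ]
variable (V V' : Subgroup Γ) [hV : IsClosed (V : Set Γ)] [hV' : IsClosed (V' : Set Γ)]
  [hVn : V.Normal] [hV'n : V'.Normal]
variable {M : Type u} [AddCommGroup M] [TopologicalSpace M] [DiscreteTopology M]
variable (ρ : ContinuousRep Γ ℤ M)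

omit [CompactSpace Γ] [T2Space Γ] [TotallyDisconnectedSpace Γ] hV hV' in
/-- The tree's action `conjMap` of `g₀ ∈ V` on `H^q(V'.subgroupOf V, M)` (ambient group `↥V`) IS the action `conjMapSubOf` of
`g₀ ∈ Γ` of `CorestrictionSubgroupOfConj.lean` (both are the map of the pair `(s ↦ g₀⁻¹ s g₀, m ↦ g₀·m)`).
[cite: NeukirchSchmidtWingberg2008, I §5 Prop. 1.5.4] -/
theorem conjMap_restrict_subgroupOf_eq_conjMapSubOf (g₀ : V) (q : ℕ)
    (z : continuousCohomology q (repSub V V' ρ).toTopRep) :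
    conjMap (ρ.restrict (subgroupIncl V)).toTopRep (V'.subgroupOf V) g₀ q z = conjMapSubOf V V' ρ (g₀ : Γ) q z := by
  have h1 := map_comp_apply_of (X := (repSub V V' ρ).toTopRep) (Y := (repSub V V' ρ).toTopRep)
    (Z := (repSub V V' ρ).toTopRep) (subgroupConj (V'.subgroupOf V) g₀)
    (ContinuousMonoidHom.id (V'.subgroupOf V : Subgroup V)) (subOfConj V V' (g₀ : Γ))
    (fun _ => Subtype.ext (Subtype.ext rfl)) (conjRepHom (ρ.restrict (subgroupIncl V)).toTopRep (V'.subgroupOf V) g₀)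
    (𝟙 (repSub V V' ρ).toTopRep) (subOfConjRepHom V V' ρ (g₀ : Γ)) (fun _ => rfl) q z
  have h0 : ContinuousCohomology.map (X := (repSub V V' ρ).toTopRep) (Y := (repSub V V' ρ).toTopRep)
      (ContinuousMonoidHom.id (V'.subgroupOf V : Subgroup V)) (𝟙 (repSub V V' ρ).toTopRep) q
      (conjMap (ρ.restrict (subgroupIncl V)).toTopRep (V'.subgroupOf V) g₀ q z) =
      conjMap (ρ.restrict (subgroupIncl V)).toTopRep (V'.subgroupOf V) g₀ q z := by
    rw [ContinuousCohomology.map_id (repSub V V' ρ).toTopRep q]; rfl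
  rw [← h0]
  exact h1.symm

omit [CompactSpace Γ] [T2Space Γ] [TotallyDisconnectedSpace Γ] hV hV' in
/-- **Transport of an eigen-relation from `H^q(V', M)` to `H^q(V'.subgroupOf V, M|_V)`**: if `g₀ ∈ V` acts on `H^q(V', M)` as the scalar
`u`, it acts on `H^q(V'.subgroupOf V, M|_V)` (ambient `↥V`) as `u` (through the mutually inverse comparisons `ofSubgroupOf`,
`toSubgroupOf` and their equivariance `ofSubgroupOf_conjMapSubOf`). [cite: NeukirchSchmidtWingberg2008, I §5 Prop. 1.5.4] -/
theorem conjMap_restrict_subgroupOf_eq_zsmul (h : V' ≤ V) (g₀ : V) (q : ℕ) (u : ℤ)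
    (hu : ∀ y : continuousCohomology q (ρ.restrict (subgroupIncl V')).toTopRep, conjMap ρ.toTopRep V' (g₀ : Γ) q y = u • y)
    (z : continuousCohomology q (repSub V V' ρ).toTopRep) :
    conjMap (ρ.restrict (subgroupIncl V)).toTopRep (V'.subgroupOf V) g₀ q z = u • z := by
  rw [conjMap_restrict_subgroupOf_eq_conjMapSubOf]
  have e := ofSubgroupOf_conjMapSubOf V V' ρ (g₀ : Γ) h q z
  rw [hu, ← map_zsmul] at e
  have e' := congrArg (toSubgroupOf ρ.toTopRep h q) e
  rwa [toSubgroupOf_ofSubgroupOf, toSubgroupOf_ofSubgroupOf] at e'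

end Transport

end Literature.NumberTheory.GaloisRepresentations

/-! ## §2 The untwisted local coefficients `μ_{p^k}(K̄)|_{Γ_{K_v}}`: `Γ_{K_v}` acts trivially on `H²(N, ·)` -/

namespace Literature.NumberTheory.ComplexMultiplication.EllipticUnits.JohnsonLeungKings2011.ClassGroupRow

open Literature.NumberTheory.GaloisCohomology.ShaLayer (locHom)

section Untwisted

variable {K : Type} [Field K] [NumberField K] (v : HeightOneSpectrum (𝓞 K)) {p k : ℕ}

/-- **(LI) for the untwisted local coefficients of the class-group row.**  For `N ⊴ Γ_{K_v}` open with `Γ_{K_v}/N` abelian, `p` prime and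
`k ≥ 2`, every `g ∈ Γ_{K_v}` acts trivially on `H²(N, μ_{p^k}(K̄)|_{Γ_{K_v}})` — the hypothesis `hLI` of
`conjMap_two_eq_zsmul_of_untwisted_trivial`: transport of `conjMap_two_mu_eq_self_of_comm_mem` (local field `K_v`, coefficients
`μ_{p^k}(K̄_v)`) along the isomorphism `μ_{p^k}(K̄)|_{Γ_{K_v}} ≅ μ_{p^k}(K̄_v)` (`muLocalIso`, twist law with `u = 1`).
[cite: SerreLocalFields1979, XI §2 Prop. 1 (ii), XIII §3 Prop. 7] [cite: JohnsonLeungKings2011, §5.4 Lemma 5.8 (proof)] -/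
theorem conjMap_two_muRestrict_eq_self (hp : p.Prime) (hk : 2 ≤ k)
    (N : Subgroup (absoluteGaloisGroup (v.adicCompletion K))) [N.Normal]
    (hNo : IsOpen (N : Set (absoluteGaloisGroup (v.adicCompletion K))))
    (hab : ∀ x y : absoluteGaloisGroup (v.adicCompletion K), x * y * x⁻¹ * y⁻¹ ∈ N)
    (g : absoluteGaloisGroup (v.adicCompletion K))
    (z : continuousCohomology 2 (subgroupRep ((mu K (p ^ k)).restrict (absGaloisRestrict K (v.adicCompletion K))).toTopRep N)) :
    conjMap ((mu K (p ^ k)).restrict (absGaloisRestrict K (v.adicCompletion K))).toTopRep N g 2 z = z := by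
  haveI := charZero_adicCompletion v
  haveI : NeZero (p ^ k) := ⟨pow_ne_zero k hp.ne_zero⟩
  haveI hNc : IsClosed (N : Set (absoluteGaloisGroup (v.adicCompletion K))) := N.isClosed_of_isOpen hNo
  haveI : CompactSpace N := compactSpace_of_isClosed_subgroup (S := N)
  have hX := conjMap_two_eq_zsmul_of_twist
    ((mu K (p ^ k)).restrict (absGaloisRestrict K (v.adicCompletion K))).toTopRep
    (mu (v.adicCompletion K) (p ^ k)).toTopRep N (resModHom N (muLocalIso v (p ^ k)).hom) g 1
    (fun w => ?_) ?_ (fun y => conjMap_two_mu_eq_self_of_comm_mem (v.adicCompletion K) hp hk N hNo hab g y) z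
  · rw [hX, one_zsmul]
  · rw [one_zsmul]
    exact TopRep.hom_comm_apply (muLocalIso v (p ^ k)).hom g w
  · refine cohomologyMap_injective_of_leftInverse _ (resModHom N (muLocalIso v (p ^ k)).inv) fun a => ?_
    change ((muLocalIso v (p ^ k)).hom ≫ (muLocalIso v (p ^ k)).inv).hom a = a
    rw [(muLocalIso v (p ^ k)).hom_inv_id]
    rfl

end Untwisted

/-! ## §3 The per-place inputs: `2·(δ·c − θ′(δ)·c) = 0` and `4·c = 0` on `H²(Λ, res_{φ_v}(μ_{p^k} ⊗ θ′)^{N_S})` -/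

section PerPlace

variable {K : Type} [Field K] [NumberField K] (p : ℕ) [Fact p.Prime] (θ' : absoluteGaloisGroup K →ₜ* ℤ_[p]ˣ)
  (S : Set (HeightOneSpectrum (𝓞 K))) (k : ℕ) (v : HeightOneSpectrum (𝓞 K))
  (Λ : Subgroup (absoluteGaloisGroup (v.adicCompletion K)))

omit [NumberField K] in
/-- `−1 ≠ 1` in `ℤ_p^×`. [folklore] -/
private theorem neg_one_ne_one_units : (-1 : ℤ_[p]ˣ) ≠ 1 := by
  intro h
  have h1 : ((-1 : ℤ_[p]ˣ) : ℤ_[p]) = ((1 : ℤ_[p]ˣ) : ℤ_[p]) := by rw [h]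
  rw [Units.val_neg, Units.val_one] at h1
  have h2 : (2 : ℤ_[p]) = 0 := by
    have h3 := eq_neg_iff_add_eq_zero.mp h1.symm
    rwa [one_add_one_eq_two] at h3
  exact two_ne_zero h2

/-- **The kernel `K₀ = {s ∈ Γ_{K_v} : θ′(res_v s) = 1}` is OPEN when `θ′ ∘ res_v` takes only the values `±1`** (it is the preimage of the
open set `{u ≠ −1}`). [folklore] -/
private theorem isOpen_ker_comp_absGaloisRestrict
    (hθ2 : ∀ s : absoluteGaloisGroup (v.adicCompletion K),
      θ' (absGaloisRestrict K (v.adicCompletion K) s) = 1 ∨ θ' (absGaloisRestrict K (v.adicCompletion K) s) = -1) :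
    IsOpen ((((θ' : absoluteGaloisGroup K →* ℤ_[p]ˣ).comp
      (absGaloisRestrict K (v.adicCompletion K) : absoluteGaloisGroup (v.adicCompletion K) →* absoluteGaloisGroup K)).ker :
        Subgroup (absoluteGaloisGroup (v.adicCompletion K))) : Set (absoluteGaloisGroup (v.adicCompletion K))) := by
  have hc : Continuous fun s : absoluteGaloisGroup (v.adicCompletion K) => θ' (absGaloisRestrict K (v.adicCompletion K) s) :=
    θ'.continuous_toFun.comp (absGaloisRestrict K (v.adicCompletion K)).continuous_toFun
  have hset : ((((θ' : absoluteGaloisGroup K →* ℤ_[p]ˣ).comp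
      (absGaloisRestrict K (v.adicCompletion K) : absoluteGaloisGroup (v.adicCompletion K) →* absoluteGaloisGroup K)).ker :
        Subgroup (absoluteGaloisGroup (v.adicCompletion K))) : Set (absoluteGaloisGroup (v.adicCompletion K))) =
      (fun s : absoluteGaloisGroup (v.adicCompletion K) => θ' (absGaloisRestrict K (v.adicCompletion K) s)) ⁻¹' {(-1 : ℤ_[p]ˣ)}ᶜ := by
    ext s
    change θ' (absGaloisRestrict K (v.adicCompletion K) s) = 1 ↔ θ' (absGaloisRestrict K (v.adicCompletion K) s) ∈ ({(-1 : ℤ_[p]ˣ)}ᶜ : Set ℤ_[p]ˣ)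
    rw [Set.mem_compl_iff, Set.mem_singleton_iff]
    constructor
    · intro h1 h2; rw [h1] at h2; exact neg_one_ne_one_units p h2.symm
    · intro h2; rcases hθ2 s with h1 | h1
      · exact h1
      · exact absurd h1 h2
  rw [hset]
  exact (isOpen_compl_singleton).preimage hc

/-- **`g ∈ Γ_{K_v}` acts on `H²(Λ ∩ K₀, res_{φ_v}(μ_{p^k} ⊗ θ′)^{N_S})` as the scalar `(θ′(res_v g) mod p^k).val`**, for `Λ ⊴ Γ_{K_v}` open with
abelian quotient, `K₀ = ker(θ′ ∘ res_v)` (values `±1`), `k ≥ 2`, `N_S ≤ ker(μ_{p^k} ⊗ θ′)`: `conjMap_two_eq_zsmul_of_untwisted_trivial` fed with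
`conjMap_two_muRestrict_eq_self`. [cite: JohnsonLeungKings2011, §5.4 Lemma 5.8 (proof)] [cite: SerreLocalFields1979, XIII §3 Prop. 7] -/
theorem conjMap_two_inf_ker_eq_zsmul (hk : 2 ≤ k) (hμ : ramificationSubgroup K S ≤ ContinuousRep.ker (muTwist p θ' k))
    [Λ.Normal] (hΛo : IsOpen (Λ : Set (absoluteGaloisGroup (v.adicCompletion K))))
    (habΛ : ∀ x y : absoluteGaloisGroup (v.adicCompletion K), x * y * x⁻¹ * y⁻¹ ∈ Λ)
    (hθ2 : ∀ s : absoluteGaloisGroup (v.adicCompletion K),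
      θ' (absGaloisRestrict K (v.adicCompletion K) s) = 1 ∨ θ' (absGaloisRestrict K (v.adicCompletion K) s) = -1)
    (g : absoluteGaloisGroup (v.adicCompletion K))
    (w : continuousCohomology 2 (subgroupRep (TopRep.res (locHom (S := S) v : absoluteGaloisGroup (v.adicCompletion K) →*
        GaloisGroupUnramifiedOutside K S) ((muTwist p θ' k).quotientInvariants (ramificationSubgroup K S)).toTopRep)
        (Λ ⊓ ((θ' : absoluteGaloisGroup K →* ℤ_[p]ˣ).comp
          (absGaloisRestrict K (v.adicCompletion K) : absoluteGaloisGroup (v.adicCompletion K) →* absoluteGaloisGroup K)).ker))) :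
    conjMap (TopRep.res (locHom (S := S) v : absoluteGaloisGroup (v.adicCompletion K) →* GaloisGroupUnramifiedOutside K S)
        ((muTwist p θ' k).quotientInvariants (ramificationSubgroup K S)).toTopRep)
      (Λ ⊓ ((θ' : absoluteGaloisGroup K →* ℤ_[p]ˣ).comp
          (absGaloisRestrict K (v.adicCompletion K) : absoluteGaloisGroup (v.adicCompletion K) →* absoluteGaloisGroup K)).ker) g 2 w =
      ((charModPow p θ' k (absGaloisRestrict K (v.adicCompletion K) g)).val : ℤ) • w := by
  haveI := charZero_adicCompletion v
  have hNo : IsOpen ((Λ ⊓ ((θ' : absoluteGaloisGroup K →* ℤ_[p]ˣ).comp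
      (absGaloisRestrict K (v.adicCompletion K) : absoluteGaloisGroup (v.adicCompletion K) →* absoluteGaloisGroup K)).ker :
        Subgroup (absoluteGaloisGroup (v.adicCompletion K))) : Set (absoluteGaloisGroup (v.adicCompletion K))) :=
    hΛo.inter (isOpen_ker_comp_absGaloisRestrict p θ' v hθ2)
  haveI : IsClosed ((Λ ⊓ ((θ' : absoluteGaloisGroup K →* ℤ_[p]ˣ).comp
      (absGaloisRestrict K (v.adicCompletion K) : absoluteGaloisGroup (v.adicCompletion K) →* absoluteGaloisGroup K)).ker :
        Subgroup (absoluteGaloisGroup (v.adicCompletion K))) : Set (absoluteGaloisGroup (v.adicCompletion K))) :=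
    Subgroup.isClosed_of_isOpen _ hNo
  haveI : CompactSpace (Λ ⊓ ((θ' : absoluteGaloisGroup K →* ℤ_[p]ˣ).comp
      (absGaloisRestrict K (v.adicCompletion K) : absoluteGaloisGroup (v.adicCompletion K) →* absoluteGaloisGroup K)).ker :
        Subgroup (absoluteGaloisGroup (v.adicCompletion K))) := compactSpace_of_isClosed_subgroup (S := _)
  refine conjMap_two_eq_zsmul_of_untwisted_trivial p θ' S k v _ hμ (fun s hs => (MonoidHom.mem_ker).mp (Subgroup.mem_inf.mp hs).2) g
    (fun z => conjMap_two_muRestrict_eq_self v (Fact.out : p.Prime) hk _ hNo (fun x y => Subgroup.mem_inf.mpr ⟨habΛ x y, ?_⟩) g z) w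
  rw [MonoidHom.mem_ker, map_mul, map_mul, map_mul, map_inv, map_inv, mul_inv_cancel_comm, mul_inv_cancel]


/-- **`(Λ : Λ ∩ K₀) ∈ {1, 2}`** when `θ′ ∘ res_v` takes only the values `±1` (`K₀ = ker(θ′ ∘ res_v)`; the index is the size of the image
of `Λ` in `{±1}`). [folklore] -/
private theorem index_inf_ker_subgroupOf
    (hθ2 : ∀ s : absoluteGaloisGroup (v.adicCompletion K), θ' (absGaloisRestrict K (v.adicCompletion K) s) = 1 ∨ θ' (absGaloisRestrict K (v.adicCompletion K) s) = -1) :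
    ((Λ ⊓ ((θ' : absoluteGaloisGroup K →* ℤ_[p]ˣ).comp (absGaloisRestrict K (v.adicCompletion K) : absoluteGaloisGroup (v.adicCompletion K) →* absoluteGaloisGroup K)).ker).subgroupOf Λ).index = 1 ∨ ((Λ ⊓ ((θ' : absoluteGaloisGroup K →* ℤ_[p]ˣ).comp (absGaloisRestrict K (v.adicCompletion K) : absoluteGaloisGroup (v.adicCompletion K) →* absoluteGaloisGroup K)).ker).subgroupOf Λ).index = 2 := by
  have e1 : (Λ ⊓ ((θ' : absoluteGaloisGroup K →* ℤ_[p]ˣ).comp (absGaloisRestrict K (v.adicCompletion K) : absoluteGaloisGroup (v.adicCompletion K) →* absoluteGaloisGroup K)).ker).subgroupOf Λ =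
      ((((θ' : absoluteGaloisGroup K →* ℤ_[p]ˣ).comp (absGaloisRestrict K (v.adicCompletion K) : absoluteGaloisGroup (v.adicCompletion K) →* absoluteGaloisGroup K))).comp Λ.subtype).ker := by
    rw [Subgroup.inf_subgroupOf_left]
    exact MonoidHom.comap_ker _ Λ.subtype
  rw [e1, Subgroup.index_ker]
  change Nat.card (((((((θ' : absoluteGaloisGroup K →* ℤ_[p]ˣ).comp (absGaloisRestrict K (v.adicCompletion K) : absoluteGaloisGroup (v.adicCompletion K) →* absoluteGaloisGroup K))).comp Λ.subtype).range : Subgroup ℤ_[p]ˣ) : Set ℤ_[p]ˣ)) = 1 ∨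
    Nat.card (((((((θ' : absoluteGaloisGroup K →* ℤ_[p]ˣ).comp (absGaloisRestrict K (v.adicCompletion K) : absoluteGaloisGroup (v.adicCompletion K) →* absoluteGaloisGroup K))).comp Λ.subtype).range : Subgroup ℤ_[p]ˣ) : Set ℤ_[p]ˣ)) = 2
  rw [Nat.card_coe_set_eq]
  have hsub : ((((((θ' : absoluteGaloisGroup K →* ℤ_[p]ˣ).comp (absGaloisRestrict K (v.adicCompletion K) : absoluteGaloisGroup (v.adicCompletion K) →* absoluteGaloisGroup K))).comp Λ.subtype).range : Subgroup ℤ_[p]ˣ) : Set ℤ_[p]ˣ) ⊆ {1, -1} := by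
    rintro _ ⟨s, rfl⟩
    change θ' (absGaloisRestrict K (v.adicCompletion K) (s : absoluteGaloisGroup (v.adicCompletion K))) ∈ ({1, -1} : Set ℤ_[p]ˣ)
    rw [Set.mem_insert_iff, Set.mem_singleton_iff]
    exact hθ2 s
  have hfin : ({1, -1} : Set ℤ_[p]ˣ).Finite := (Set.finite_singleton _).insert _
  have hle : ((((((θ' : absoluteGaloisGroup K →* ℤ_[p]ˣ).comp (absGaloisRestrict K (v.adicCompletion K) : absoluteGaloisGroup (v.adicCompletion K) →* absoluteGaloisGroup K))).comp Λ.subtype).range : Subgroup ℤ_[p]ˣ) : Set ℤ_[p]ˣ).ncard ≤ 2 :=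
    (Set.ncard_le_ncard hsub hfin).trans ((Set.ncard_insert_le _ _).trans (by rw [Set.ncard_singleton]))
  have hpos : 0 < ((((((θ' : absoluteGaloisGroup K →* ℤ_[p]ˣ).comp (absGaloisRestrict K (v.adicCompletion K) : absoluteGaloisGroup (v.adicCompletion K) →* absoluteGaloisGroup K))).comp Λ.subtype).range : Subgroup ℤ_[p]ˣ) : Set ℤ_[p]ˣ).ncard :=
    (Set.ncard_pos (hfin.subset hsub)).mpr ⟨1, SetLike.mem_coe.mpr (one_mem _)⟩
  omega

/-- **(LI-conj) — the conjugation clause of `JLKDescent.classGroupRow_hfcoker`'s `hplaces`, up to the factor `2`.**  For `Λ ⊴ Γ_{K_v}`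
open with abelian quotient, `θ′ ∘ res_v` with values `±1`, `k ≥ 2`, `N_S ≤ ker(μ_{p^k} ⊗ θ′)` and EVERY `δ ∈ Γ_{K_v}`:
`2 · (δ·c − (θ′(res_v δ) mod p^k).val · c) = 0` on `H²(Λ, res_{φ_v}(μ_{p^k} ⊗ θ′)^{N_S})` — the relation holds exactly on `Λ ∩ K₀`
(`conjMap_two_inf_ker_eq_zsmul`), so the difference dies under `res_{Λ∩K₀/Λ}` (`resLe_conjMap`) and is killed by `(Λ : Λ ∩ K₀) ∣ 2`
(`index_smul_eq_zero_of_resH_eq_zero`). [cite: JohnsonLeungKings2011, §5.4 Lemma 5.8 (proof)] [cite: SerreGaloisCohomology1997, I §2.4 Prop. 9] -/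
theorem two_smul_conjMap_sub_zsmul_eq_zero (hk : 2 ≤ k) (hμ : ramificationSubgroup K S ≤ ContinuousRep.ker (muTwist p θ' k))
    [Λ.Normal] (hΛo : IsOpen (Λ : Set (absoluteGaloisGroup (v.adicCompletion K))))
    (habΛ : ∀ x y : absoluteGaloisGroup (v.adicCompletion K), x * y * x⁻¹ * y⁻¹ ∈ Λ)
    (hθ2 : ∀ s : absoluteGaloisGroup (v.adicCompletion K), θ' (absGaloisRestrict K (v.adicCompletion K) s) = 1 ∨ θ' (absGaloisRestrict K (v.adicCompletion K) s) = -1)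
    (δ : absoluteGaloisGroup (v.adicCompletion K)) (c : continuousCohomology 2 (subgroupRep (TopRep.res (locHom (S := S) v : absoluteGaloisGroup (v.adicCompletion K) →* GaloisGroupUnramifiedOutside K S) ((muTwist p θ' k).quotientInvariants (ramificationSubgroup K S)).toTopRep) Λ)) :
    2 • (conjMap (TopRep.res (locHom (S := S) v : absoluteGaloisGroup (v.adicCompletion K) →* GaloisGroupUnramifiedOutside K S) ((muTwist p θ' k).quotientInvariants (ramificationSubgroup K S)).toTopRep) Λ δ 2 c - ((charModPow p θ' k (absGaloisRestrict K (v.adicCompletion K) δ)).val : ℤ) • c) = 0 := by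
  haveI := charZero_adicCompletion v
  haveI hΛc : IsClosed (Λ : Set (absoluteGaloisGroup (v.adicCompletion K))) := Subgroup.isClosed_of_isOpen _ hΛo
  haveI : CompactSpace Λ := compactSpace_of_isClosed_subgroup (S := Λ)
  have hNo : IsOpen (((Λ ⊓ ((θ' : absoluteGaloisGroup K →* ℤ_[p]ˣ).comp (absGaloisRestrict K (v.adicCompletion K) : absoluteGaloisGroup (v.adicCompletion K) →* absoluteGaloisGroup K)).ker) : Subgroup (absoluteGaloisGroup (v.adicCompletion K))) : Set (absoluteGaloisGroup (v.adicCompletion K))) := hΛo.inter (isOpen_ker_comp_absGaloisRestrict p θ' v hθ2)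
  haveI : IsClosed (((Λ ⊓ ((θ' : absoluteGaloisGroup K →* ℤ_[p]ˣ).comp (absGaloisRestrict K (v.adicCompletion K) : absoluteGaloisGroup (v.adicCompletion K) →* absoluteGaloisGroup K)).ker) : Subgroup (absoluteGaloisGroup (v.adicCompletion K))) : Set (absoluteGaloisGroup (v.adicCompletion K))) := Subgroup.isClosed_of_isOpen _ hNo
  -- everything below in the currency `ρ.toTopRep`, `ρ := res_{φ_v}(μ ⊗ θ′)^{N_S}` (definitionally the `TopRep.res` of the statement)
  obtain ⟨c, rfl⟩ : ∃ c' : continuousCohomology 2 (subgroupRep (((muTwist p θ' k).quotientInvariants (ramificationSubgroup K S)).restrict (locHom (S := S) v)).toTopRep Λ), c' = c := ⟨c, rfl⟩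
  change 2 • (conjMap (((muTwist p θ' k).quotientInvariants (ramificationSubgroup K S)).restrict (locHom (S := S) v)).toTopRep Λ δ 2 c - ((charModPow p θ' k (absGaloisRestrict K (v.adicCompletion K) δ)).val : ℤ) • c) = 0
  have hA : ∀ w : continuousCohomology 2 (subgroupRep (((muTwist p θ' k).quotientInvariants (ramificationSubgroup K S)).restrict (locHom (S := S) v)).toTopRep (Λ ⊓ ((θ' : absoluteGaloisGroup K →* ℤ_[p]ˣ).comp (absGaloisRestrict K (v.adicCompletion K) : absoluteGaloisGroup (v.adicCompletion K) →* absoluteGaloisGroup K)).ker)),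
      conjMap (((muTwist p θ' k).quotientInvariants (ramificationSubgroup K S)).restrict (locHom (S := S) v)).toTopRep (Λ ⊓ ((θ' : absoluteGaloisGroup K →* ℤ_[p]ˣ).comp (absGaloisRestrict K (v.adicCompletion K) : absoluteGaloisGroup (v.adicCompletion K) →* absoluteGaloisGroup K)).ker) δ 2 w = ((charModPow p θ' k (absGaloisRestrict K (v.adicCompletion K) δ)).val : ℤ) • w :=
    fun w => conjMap_two_inf_ker_eq_zsmul p θ' S k v Λ hk hμ hΛo habΛ hθ2 δ w
  have hres : resLe (((muTwist p θ' k).quotientInvariants (ramificationSubgroup K S)).restrict (locHom (S := S) v)).toTopRep (inf_le_left : (Λ ⊓ ((θ' : absoluteGaloisGroup K →* ℤ_[p]ˣ).comp (absGaloisRestrict K (v.adicCompletion K) : absoluteGaloisGroup (v.adicCompletion K) →* absoluteGaloisGroup K)).ker) ≤ Λ) 2 (conjMap (((muTwist p θ' k).quotientInvariants (ramificationSubgroup K S)).restrict (locHom (S := S) v)).toTopRep Λ δ 2 c - ((charModPow p θ' k (absGaloisRestrict K (v.adicCompletion K) δ)).val : ℤ) • c) = 0 := by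
    rw [map_sub, map_zsmul, resLe_conjMap Λ (Λ ⊓ ((θ' : absoluteGaloisGroup K →* ℤ_[p]ˣ).comp (absGaloisRestrict K (v.adicCompletion K) : absoluteGaloisGroup (v.adicCompletion K) →* absoluteGaloisGroup K)).ker) (((muTwist p θ' k).quotientInvariants (ramificationSubgroup K S)).restrict (locHom (S := S) v)) δ inf_le_left 2 c, hA]
    exact sub_self _
  have hz : resH ((Λ ⊓ ((θ' : absoluteGaloisGroup K →* ℤ_[p]ˣ).comp (absGaloisRestrict K (v.adicCompletion K) : absoluteGaloisGroup (v.adicCompletion K) →* absoluteGaloisGroup K)).ker).subgroupOf Λ) ((((muTwist p θ' k).quotientInvariants (ramificationSubgroup K S)).restrict (locHom (S := S) v)).restrict (subgroupIncl Λ)) 2 (conjMap (((muTwist p θ' k).quotientInvariants (ramificationSubgroup K S)).restrict (locHom (S := S) v)).toTopRep Λ δ 2 c - ((charModPow p θ' k (absGaloisRestrict K (v.adicCompletion K) δ)).val : ℤ) • c) = 0 := by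
    rw [← toSubgroupOf_resLe Λ (Λ ⊓ ((θ' : absoluteGaloisGroup K →* ℤ_[p]ˣ).comp (absGaloisRestrict K (v.adicCompletion K) : absoluteGaloisGroup (v.adicCompletion K) →* absoluteGaloisGroup K)).ker) (((muTwist p θ' k).quotientInvariants (ramificationSubgroup K S)).restrict (locHom (S := S) v)) inf_le_left 2, hres, map_zero]
    rfl
  have hidx := index_smul_eq_zero_of_resH_eq_zero ((((muTwist p θ' k).quotientInvariants (ramificationSubgroup K S)).restrict (locHom (S := S) v)).restrict (subgroupIncl Λ)) ((Λ ⊓ ((θ' : absoluteGaloisGroup K →* ℤ_[p]ˣ).comp (absGaloisRestrict K (v.adicCompletion K) : absoluteGaloisGroup (v.adicCompletion K) →* absoluteGaloisGroup K)).ker).subgroupOf Λ)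
    (hNo.preimage continuous_subtype_val) _ hz
  rcases index_inf_ker_subgroupOf p θ' v Λ hθ2 with h1 | h2
  · rw [h1, one_smul] at hidx
    rw [hidx]
    exact smul_zero _
  · rw [h2] at hidx
    exact hidx

omit [NumberField K] in
/-- `(θ′(g₀) mod p^k).val • w = −w` on a `p^k`-torsion element when `θ′(g₀) = −1`. [folklore] -/
private theorem val_zsmul_eq_neg_of_apply_eq_neg_one {M : Type*} [AddCommGroup M] (g₀ : absoluteGaloisGroup K)
    (hθg₀ : θ' g₀ = -1) (w : M) (hw : (p ^ k) • w = 0) :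
    ((charModPow p θ' k g₀).val : ℤ) • w = (-1 : ℤ) • w := by
  have hc : charModPow p θ' k g₀ = -1 := by
    rw [charModPow_apply, hθg₀, Units.val_neg, Units.val_one, map_neg, map_one]
  have hcast : (((charModPow p θ' k g₀).val : ℤ) : ZMod (p ^ k)) = ((-1 : ℤ) : ZMod (p ^ k)) := by
    rw [Int.cast_natCast, ZMod.natCast_zmod_val, hc, Int.cast_neg, Int.cast_one]
  obtain ⟨m, hm⟩ := (ZMod.intCast_eq_intCast_iff_dvd_sub _ _ (p ^ k)).mp hcast
  have e : (-1 : ℤ) = ((charModPow p θ' k g₀).val : ℤ) + m * (p ^ k : ℕ) := by rw [mul_comm, ← hm]; ring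
  rw [e, add_zsmul, mul_zsmul, natCast_zsmul w (p ^ k), hw, zsmul_zero, add_zero]

/-- **(LI-ram) — the KILL clause of `JLKDescent.classGroupRow_hfcoker`'s `hplaces`: `4·c = 0` on `H²(Λ, res_{φ_v}(μ_{p^k} ⊗ θ′)^{N_S})`**
whenever `Λ` contains an element `g₀` with `θ′(res_v g₀) = −1` (`Λ ⊴ Γ_{K_v}` open with abelian quotient, `θ′ ∘ res_v` with values `±1`,
`k ≥ 2`, `N_S ≤ ker`): `g₀` acts on `H²(Λ ∩ K₀, ·)` as `−1` (`conjMap_two_inf_ker_eq_zsmul` and `p^k`-torsion), transported to the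
ambient group `↥Λ` (`conjMap_restrict_subgroupOf_eq_zsmul`), so `(Λ : Λ∩K₀)·2·c = 0` (`index_smul_zsmul_eq_zero_of_conjMap_eq_zsmul`),
and `(Λ : Λ ∩ K₀) ∣ 2`. (Typical use: `v ∤ p` a place where `θ′` is ramified, `g₀` an inertia element, which lies in every layer group.)
[cite: JohnsonLeungKings2011, §5.4 Lemma 5.8 (proof)] [cite: SerreLocalFields1979, VII §5 Prop. 3] -/
theorem four_smul_eq_zero_of_apply_eq_neg_one (hk : 2 ≤ k) (hμ : ramificationSubgroup K S ≤ ContinuousRep.ker (muTwist p θ' k))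
    [Λ.Normal] (hΛo : IsOpen (Λ : Set (absoluteGaloisGroup (v.adicCompletion K))))
    (habΛ : ∀ x y : absoluteGaloisGroup (v.adicCompletion K), x * y * x⁻¹ * y⁻¹ ∈ Λ)
    (hθ2 : ∀ s : absoluteGaloisGroup (v.adicCompletion K), θ' (absGaloisRestrict K (v.adicCompletion K) s) = 1 ∨ θ' (absGaloisRestrict K (v.adicCompletion K) s) = -1)
    (g₀ : absoluteGaloisGroup (v.adicCompletion K)) (hg₀ : g₀ ∈ Λ) (hθg₀ : θ' (absGaloisRestrict K (v.adicCompletion K) g₀) = -1)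
    (c : continuousCohomology 2 (subgroupRep (TopRep.res (locHom (S := S) v : absoluteGaloisGroup (v.adicCompletion K) →* GaloisGroupUnramifiedOutside K S) ((muTwist p θ' k).quotientInvariants (ramificationSubgroup K S)).toTopRep) Λ)) : 4 • c = 0 := by
  haveI := charZero_adicCompletion v
  haveI hΛc : IsClosed (Λ : Set (absoluteGaloisGroup (v.adicCompletion K))) := Subgroup.isClosed_of_isOpen _ hΛo
  haveI : CompactSpace Λ := compactSpace_of_isClosed_subgroup (S := Λ)
  have hNo : IsOpen (((Λ ⊓ ((θ' : absoluteGaloisGroup K →* ℤ_[p]ˣ).comp (absGaloisRestrict K (v.adicCompletion K) : absoluteGaloisGroup (v.adicCompletion K) →* absoluteGaloisGroup K)).ker) : Subgroup (absoluteGaloisGroup (v.adicCompletion K))) : Set (absoluteGaloisGroup (v.adicCompletion K))) := hΛo.inter (isOpen_ker_comp_absGaloisRestrict p θ' v hθ2)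
  haveI : IsClosed (((Λ ⊓ ((θ' : absoluteGaloisGroup K →* ℤ_[p]ˣ).comp (absGaloisRestrict K (v.adicCompletion K) : absoluteGaloisGroup (v.adicCompletion K) →* absoluteGaloisGroup K)).ker) : Subgroup (absoluteGaloisGroup (v.adicCompletion K))) : Set (absoluteGaloisGroup (v.adicCompletion K))) := Subgroup.isClosed_of_isOpen _ hNo
  haveI : IsClosed ((((Λ ⊓ ((θ' : absoluteGaloisGroup K →* ℤ_[p]ˣ).comp (absGaloisRestrict K (v.adicCompletion K) : absoluteGaloisGroup (v.adicCompletion K) →* absoluteGaloisGroup K)).ker).subgroupOf Λ : Subgroup Λ)) : Set Λ) := isClosed_subgroupOf_of_isClosed Λ (Λ ⊓ ((θ' : absoluteGaloisGroup K →* ℤ_[p]ˣ).comp (absGaloisRestrict K (v.adicCompletion K) : absoluteGaloisGroup (v.adicCompletion K) →* absoluteGaloisGroup K)).ker)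
  haveI : CompactSpace ((Λ ⊓ ((θ' : absoluteGaloisGroup K →* ℤ_[p]ˣ).comp (absGaloisRestrict K (v.adicCompletion K) : absoluteGaloisGroup (v.adicCompletion K) →* absoluteGaloisGroup K)).ker).subgroupOf Λ : Subgroup Λ) := compactSpace_of_isClosed_subgroup (S := _)
  -- `g₀` acts as `−1` on `H²(Λ ∩ K₀, ·)`
  have htor : ∀ w : continuousCohomology 2 (subgroupRep (((muTwist p θ' k).quotientInvariants (ramificationSubgroup K S)).restrict (locHom (S := S) v)).toTopRep (Λ ⊓ ((θ' : absoluteGaloisGroup K →* ℤ_[p]ˣ).comp (absGaloisRestrict K (v.adicCompletion K) : absoluteGaloisGroup (v.adicCompletion K) →* absoluteGaloisGroup K)).ker)), (p ^ k) • w = 0 :=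
    nsmul_two_eq_zero_of_forall _ (p ^ k) fun x => Subtype.ext (muVal_injective K (p ^ k) (by
      rw [show ((((p ^ k) • x : ↥((muTwist p θ' k).invariantsOf (ramificationSubgroup K S))) : MuCarrier K (p ^ k))) =
          (p ^ k) • (x : MuCarrier K (p ^ k)) from rfl, muVal_nsmul, muVal_pow_eq_one]
      rfl))
  have hval : ∀ w : continuousCohomology 2 (subgroupRep (((muTwist p θ' k).quotientInvariants (ramificationSubgroup K S)).restrict (locHom (S := S) v)).toTopRep (Λ ⊓ ((θ' : absoluteGaloisGroup K →* ℤ_[p]ˣ).comp (absGaloisRestrict K (v.adicCompletion K) : absoluteGaloisGroup (v.adicCompletion K) →* absoluteGaloisGroup K)).ker)),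
      conjMap (((muTwist p θ' k).quotientInvariants (ramificationSubgroup K S)).restrict (locHom (S := S) v)).toTopRep (Λ ⊓ ((θ' : absoluteGaloisGroup K →* ℤ_[p]ˣ).comp (absGaloisRestrict K (v.adicCompletion K) : absoluteGaloisGroup (v.adicCompletion K) →* absoluteGaloisGroup K)).ker) g₀ 2 w = (-1 : ℤ) • w := fun w => by
    rw [show conjMap (((muTwist p θ' k).quotientInvariants (ramificationSubgroup K S)).restrict (locHom (S := S) v)).toTopRep (Λ ⊓ ((θ' : absoluteGaloisGroup K →* ℤ_[p]ˣ).comp (absGaloisRestrict K (v.adicCompletion K) : absoluteGaloisGroup (v.adicCompletion K) →* absoluteGaloisGroup K)).ker) g₀ 2 w = ((charModPow p θ' k (absGaloisRestrict K (v.adicCompletion K) g₀)).val : ℤ) • w from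
      conjMap_two_inf_ker_eq_zsmul p θ' S k v Λ hk hμ hΛo habΛ hθ2 g₀ w]
    exact val_zsmul_eq_neg_of_apply_eq_neg_one p θ' k _ hθg₀ w (htor w)
  -- transport to the ambient group `↥Λ` and apply the index argument
  have hconj := conjMap_restrict_subgroupOf_eq_zsmul Λ (Λ ⊓ ((θ' : absoluteGaloisGroup K →* ℤ_[p]ˣ).comp (absGaloisRestrict K (v.adicCompletion K) : absoluteGaloisGroup (v.adicCompletion K) →* absoluteGaloisGroup K)).ker) (((muTwist p θ' k).quotientInvariants (ramificationSubgroup K S)).restrict (locHom (S := S) v)) inf_le_left ⟨g₀, hg₀⟩ 2 (-1) hval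
  have hB := index_smul_zsmul_eq_zero_of_conjMap_eq_zsmul ((((muTwist p θ' k).quotientInvariants (ramificationSubgroup K S)).restrict (locHom (S := S) v)).restrict (subgroupIncl Λ)) ((Λ ⊓ ((θ' : absoluteGaloisGroup K →* ℤ_[p]ˣ).comp (absGaloisRestrict K (v.adicCompletion K) : absoluteGaloisGroup (v.adicCompletion K) →* absoluteGaloisGroup K)).ker).subgroupOf Λ)
    (hNo.preimage continuous_subtype_val) ⟨g₀, hg₀⟩ (-1) hconj c
  rw [sub_neg_eq_add, one_add_one_eq_two, two_zsmul, ← two_nsmul] at hB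
  have h4 : (4 : ℕ) • c = 2 • (2 • c) := by rw [← mul_nsmul]
  rcases index_inf_ker_subgroupOf p θ' v Λ hθ2 with h1 | h2
  · rw [h1, one_smul] at hB
    have hB' : (2 : ℕ) • c = 0 := hB
    rw [h4, hB', smul_zero]
  · rw [h2] at hB
    rw [h4]
    exact hB

end PerPlace

end Literature.NumberTheory.ComplexMultiplication.EllipticUnits.JohnsonLeungKings2011.ClassGroupRow

end
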